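import Summits.HodgeConjecture.HodgeConjecture.Theorems.H413SpectrumInterfaces
import Summits.HodgeConjecture.HodgeConjecture.Theorems.H413SpectrumPartsPin
import Summits.HodgeConjecture.HodgeConjecture.Theorems.F0P3SpectralJunction
import Literature.NumberTheory.Automorphic.DiscreteSummandProjection
import Literature.NumberTheory.Automorphic.UnitaryGroupCotangentSpectralProjection
import HarnessLib

/-!
# Crux `H413`, sub-line F0-P2CohSpectrumL2, stub **U2a** (spectral projection preserving cotangent type) from the spectral-projection
# letter (D): the LIFT `θ' = ℓ⁻¹ ∘ pr_Π ∘ ℓ ∘ θ` (programme P2, seat F0P2-p03; F0P2-plan (g0) 2026-08-30T22:53:30Z word «file the U2a fold»)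

HC_CM is proved only modulo the 7 printed citations until rung 0 closes.

Stub U2a (`SpectrumInterfaces.StubU2aSpectralProjection`, ★ `Theorems/H413SpectrumInterfaces.lean`; registered in `Cruxes/H413/Lines/F0_P2CohSpectrumL2.lean`): for every
face, every automorphic measure `μ` on `U(V)(F⁺)\U(V)(𝔸_{F⁺})` and every realisation `ℓ` of the cotangent forms `cohForms 𝔞₀` (`𝔞₀ = archFactorOf F V`) in `L²(μ)`
(`Represents`), every irreducible `σ` of `U(V)(𝔸_{F⁺,f})` occurring in `cohForms 𝔞₀` occurs in the cotangent part `cotPart 𝔞₀ μ ℓ Π` of SOME discrete automorphic `Π`.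
* §1 THE LIFT ALONG ONE PROJECTION (`exists_occursIn_cotPart_of_proj`): for `Π` discrete automorphic and ANY linear `p : L² → L²` with values in `Π.space`, commuting with
  the regular action of `U(V)(𝔸_{F⁺,f})`, and LIFTING cotangent forms (`∀ f ∈ cohForms 𝔞, ∃ f' ∈ cohForms 𝔞, ∀ k, ℓ f' k = p (ℓ f k)`), every equivariant `θ : σ → cohForms 𝔞`
  with `p (ℓ (θ w₀) k₀) ≠ 0` yields a NON-ZERO equivariant `θ' : σ → cotPart 𝔞 μ ℓ Π`, `θ' w :=` THE cotangent form with coordinates `p (ℓ (θ w) k)` — well defined, linear and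
  equivariant by the INJECTIVITY of `ℓ` on `cohForms 𝔞` and the TRANSPORT `ℓ (R_g f) k = R(1,g) (ℓ f k)` (★ `SpectrumJunction.injOn_cohForms_of_descents` ∕
  `transport_of_descents`, F0P3-p04, `Theorems/H413SpectrumPartsPin.lean`).  Irreducibility of `σ` is not used.
* §2 A DETECTING FAMILY (`exists_occursIn_cotPart_of_projFamily`): if the `p_Π` moreover detect non-zero vectors, every `σ` occurring in `cohForms 𝔞` occurs in some
  `cotPart 𝔞 μ ℓ Π` — the body of `OccursInSomePart … (cotPart …)`.
* §3 AT THE PIN (`stubU2aSpectralProjection_of_letters`): `p_Π :=` the orthogonal projection `Π.space.toSubmodule.starProjection` — equivariant (★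
  `DiscreteAutomorphicRep.starProjection_rightRegular`, F0P2-p02) and detecting (`L²(μ) = L²_disc` for the anisotropic `Hm V`, ★ `exists_discreteAutomorphicRep_starProjection_ne_zero` +
  ★ `UnitaryGroup.isDiscretelyDecomposable_rightRegular_adelicGroupData`); the lifting hypothesis is the LETTER (D) ★ `CotangentForms.holCotFormSpectralProjection` ∕
  `antiholCotFormSpectralProjection` (the projection onto `Π` of a (anti)holomorphic cotangent form is one), read through `cohForms = holCotForms ⊔ conj holCotForms` and the
  identification `ℓ f k = [toQuotFun (f · k)]` under `Represents` (★ `SpectrumJunction.apply_eq_toLp_of_descents`) — `lift_of_spectralProjection`.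
So `stub_U2a_spectralProjection := stubU2aSpectralProjection_of_letters hD hD'` closes U2a MODULO the two ★ statement-only sockets (D), (D̄) and nothing else.

## References
* [BorelJacquet1979] A. Borel, H. Jacquet, Corvallis PSPM 33.1, §4.2–§4.6.  [GelfandGraevPiatetskiShapiro1969] Ch. 1 §2.3.  [Bump1997] Thm. 3.6.1 (proof, pp. 340–342).
  [Borel1997] Thm. 2.13, §8.4 (regularity behind (D)).  [Rogawski1990] §12.3.  [BorelWallach2000] VI; XIII 1.2.
* Tree: ★ `Theorems/H413SpectrumInterfaces` (`Represents`, `cotPart`, `OccursInSomePart`, `StubU2aSpectralProjection`), ★ `Theorems/H413SpectrumPartsPin` + `…JunctionPin`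
  (F0P3-p04), ★ `Theorems/F0P3SpectralJunction` (`anisotropic_Hm`, F0P3-p02), ★ `Literature/…/DiscreteSummandProjection` (F0P2-p02), ★ `Literature/…/UnitaryGroupCotangentSpectralProjection`
  (letter (D), F0-typ1), ★ `Theorems/P4StubT1ArchFactor` (`archFactorOf_isHonest`).
-/

set_option autoImplicit false

-- the mandated namespace has the single-problem summit's repeated segment (`HodgeConjecture.HodgeConjecture`)
set_option linter.dupNamespace false

noncomputable section

namespace Summit.HodgeConjecture.HodgeConjecture.Cruxes.H413.P2StubU2a

open scoped InnerProductSpace ENNReal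
open MeasureTheory NumberField
open HodgeCM.Model HodgeCM.Model.LiuIndex
open Literature.AlgebraicGeometry.Motives (CMType)
open Literature.NumberTheory.Automorphic Literature.NumberTheory.Automorphic.UnitaryGroup
open Literature.NumberTheory.Automorphic.UnitaryGroup.CotangentForms (toQuotFun holCotFormSpectralProjection antiholCotFormSpectralProjection)
open Summit.HodgeConjecture.CorCM
open Summit.HodgeConjecture.CorCM.Lines.A3Liu413 (datum413)
open Summit.HodgeConjecture.HodgeConjecture.Cruxes.H413.CohFormsCarriers
open Summit.HodgeConjecture.HodgeConjecture.Cruxes.H413.SpectrumInterfaces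
open Summit.HodgeConjecture.HodgeConjecture.Cruxes.H413.SpectrumJunction (apply_eq_toLp_of_descents injOn_cohForms_of_descents transport_of_descents
  holCotForms_eq_generic conjFun_eq_generic two_le_finrank_maximalRealSubfield)
open Summit.HodgeConjecture.HodgeConjecture.Cruxes.H413.F0P3SpectralJunction (anisotropic_Hm)

variable {F : HodgeCM.CMField} {ι₁ : F →+* ℂ} {V : HodgeCM.HermSpace3 F ι₁}

/-! ## §1  The lift along ONE projection -/

section Lift

variable {𝔞 : ArchFactor F V} {μ : Measure (adelicDatum F V).automorphicQuotient} [(adelicDatum F V).IsAutomorphicMeasure μ]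
  {ℓ : ((adelicDatum F V).Adelic → (Fin 2 → ℂ)) →ₗ[ℂ] (Fin 2 → (adelicDatum F V).L2 μ)}

/-- Two cotangent forms with the same `L²`-coordinates are equal (★ `SpectrumJunction.injOn_cohForms_of_descents` on the difference). [cite: BorelJacquet1979, §4.6] -/
theorem ell_injOn (h4 : 4 ≤ Module.finrank ℚ F) (hrep : Represents F V 𝔞 μ ℓ) {f f' : (adelicDatum F V).Adelic → (Fin 2 → ℂ)}
    (hf : f ∈ cohForms 𝔞) (hf' : f' ∈ cohForms 𝔞) (h : ∀ k : Fin 2, ℓ f k = ℓ f' k) : f = f' := by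
  refine sub_eq_zero.mp (injOn_cohForms_of_descents h4 ℓ hrep (f - f') (Submodule.sub_mem _ hf hf') fun k => ?_)
  rw [map_sub, Pi.sub_apply, h k, sub_self]

/-- **THE LIFT `θ' = ℓ⁻¹ ∘ p ∘ ℓ ∘ θ`.**  Let `4 ≤ [F:ℚ]`, `𝔞` honest, `ℓ` realise `cohForms 𝔞` in `L²(μ)`, `Π` a discrete automorphic representation and `p : L²(μ) → L²(μ)`
a linear map with values in `Π.space`, commuting with the regular action of `U(V)(𝔸_{F⁺,f})`, and LIFTING cotangent forms (`∀ f ∈ cohForms 𝔞, ∃ f' ∈ cohForms 𝔞, ∀ k,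
ℓ f' k = p (ℓ f k)`).  Then every `U(V)(𝔸_{F⁺,f})`-equivariant linear `θ : W → cohForms 𝔞` with `p (ℓ (θ w₀) k₀) ≠ 0` gives a NON-ZERO equivariant linear
`θ' : W → cotPart 𝔞 μ ℓ Π`: `θ' w` is THE cotangent form with coordinates `p (ℓ (θ w) k)` (unique by `ell_injOn`, whence linearity; equivariance by the transport ★
`transport_of_descents`).  Irreducibility of the representation on `W` is not needed. [cite: BorelJacquet1979, §4.6] [cite: Bump1997, Thm. 3.6.1 (proof, pp. 340–342)] -/
theorem exists_occursIn_cotPart_of_proj (h4 : 4 ≤ Module.finrank ℚ F) (h𝔞 : 𝔞.IsHonest) (hrep : Represents F V 𝔞 μ ℓ)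
    (π : DiscreteAutomorphicRep (adelicDatum F V) μ) (p : (adelicDatum F V).L2 μ →ₗ[ℂ] (adelicDatum F V).L2 μ) (hpπ : ∀ v, p v ∈ π.space)
    (hpR : ∀ (g : ↥(HodgeCM.HermSpace3.adelicFin V)) (v : (adelicDatum F V).L2 μ),
      p ((adelicDatum F V).rightRegular μ (finToAdelic F V g) v) = (adelicDatum F V).rightRegular μ (finToAdelic F V g) (p v))
    (hlift : ∀ f ∈ cohForms 𝔞, ∃ f' ∈ cohForms 𝔞, ∀ k : Fin 2, ℓ f' k = p (ℓ f k))
    {W : Type} [AddCommGroup W] [Module ℂ W] (σ : Representation ℂ ↥(HodgeCM.HermSpace3.adelicFin V) W)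
    (θ : W →ₗ[ℂ] ((adelicDatum F V).Adelic → (Fin 2 → ℂ))) (hθA : ∀ w, θ w ∈ cohForms 𝔞)
    (hθσ : ∀ (g : ↥(HodgeCM.HermSpace3.adelicFin V)) (w : W), θ (σ g w) = rightRep F V g (θ w))
    {w₀ : W} {k₀ : Fin 2} (h0 : p (ℓ (θ w₀) k₀) ≠ 0) :
    ∃ θ' : W →ₗ[ℂ] ((adelicDatum F V).Adelic → (Fin 2 → ℂ)),
      θ' ≠ 0 ∧ (∀ w, θ' w ∈ cotPart F V 𝔞 μ ℓ π) ∧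
        ∀ (g : ↥(HodgeCM.HermSpace3.adelicFin V)) (w : W), θ' (σ g w) = rightRep F V g (θ' w) := by
  choose L hLA hLℓ using hlift
  have hadd : ∀ w w' : W, L (θ (w + w')) (hθA (w + w')) = L (θ w) (hθA w) + L (θ w') (hθA w') := fun w w' =>
    ell_injOn h4 hrep (hLA _ _) (Submodule.add_mem _ (hLA _ _) (hLA _ _)) fun k => by
      simp only [hLℓ, map_add, Pi.add_apply]
  have hsmul : ∀ (c : ℂ) (w : W), L (θ (c • w)) (hθA (c • w)) = c • L (θ w) (hθA w) := fun c w =>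
    ell_injOn h4 hrep (hLA _ _) (Submodule.smul_mem _ c (hLA _ _)) fun k => by
      simp only [hLℓ, map_smul, Pi.smul_apply]
  let θ' : W →ₗ[ℂ] ((adelicDatum F V).Adelic → (Fin 2 → ℂ)) :=
    { toFun := fun w => L (θ w) (hθA w), map_add' := hadd, map_smul' := hsmul }
  refine ⟨θ', fun hz => h0 ?_, fun w => ?_, fun g w => ?_⟩
  · have h1 : L (θ w₀) (hθA w₀) = 0 := LinearMap.congr_fun hz w₀
    rw [← hLℓ (θ w₀) (hθA w₀) k₀, h1, map_zero, Pi.zero_apply]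
  · simp only [cotPart, Submodule.mem_inf, Submodule.mem_iInf, Submodule.mem_comap, LinearMap.coe_comp, Function.comp_apply,
      LinearMap.proj_apply]
    refine ⟨hLA (θ w) (hθA w), fun k => ?_⟩
    change ℓ (L (θ w) (hθA w)) k ∈ π.space.toSubmodule
    rw [hLℓ]
    exact hpπ _
  · change L (θ (σ g w)) (hθA (σ g w)) = rightRep F V g (L (θ w) (hθA w))
    refine ell_injOn h4 hrep (hLA _ _) (h𝔞.rightRep_mem_cohForms (hLA _ _) g) fun k => ?_
    rw [hLℓ, hθσ, transport_of_descents h4 h𝔞 ℓ hrep (hθA w) g k, hpR, ← hLℓ (θ w) (hθA w) k,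
      ← transport_of_descents h4 h𝔞 ℓ hrep (hLA _ _) g k]

end Lift

/-! ## §2  A detecting family of projections -/

section Family

variable {𝔞 : ArchFactor F V} {μ : Measure (adelicDatum F V).automorphicQuotient} [(adelicDatum F V).IsAutomorphicMeasure μ]
  {ℓ : ((adelicDatum F V).Adelic → (Fin 2 → ℂ)) →ₗ[ℂ] (Fin 2 → (adelicDatum F V).L2 μ)}

/-- **U2a FROM A DETECTING, LIFTING FAMILY OF EQUIVARIANT PROJECTIONS.**  If for every discrete automorphic `Π` a linear `p_Π : L²(μ) → Π.space ≤ L²(μ)` commutes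
with the regular action of `U(V)(𝔸_{F⁺,f})` and lifts cotangent forms, and the family DETECTS (`v ≠ 0 ⇒ ∃ Π, p_Π v ≠ 0`), then every representation `σ` with a non-zero
equivariant `θ : σ → cohForms 𝔞` has a non-zero equivariant `θ' : σ → cotPart 𝔞 μ ℓ Π` for some `Π`: pick `w₀` with `θ w₀ ≠ 0`, a coordinate `k₀` with `ℓ (θ w₀) k₀ ≠ 0`
(injectivity of `ℓ` on `cohForms 𝔞`), a `Π` detecting it, and lift (§1).  This is the body of `OccursInSomePart … (cotPart …)` at every face. [cite: BorelJacquet1979, §4.6]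
[cite: GelfandGraevPiatetskiShapiro1969, Ch. 1 §2.3] -/
theorem exists_occursIn_cotPart_of_projFamily (h4 : 4 ≤ Module.finrank ℚ F) (h𝔞 : 𝔞.IsHonest) (hrep : Represents F V 𝔞 μ ℓ)
    (p : DiscreteAutomorphicRep (adelicDatum F V) μ → ((adelicDatum F V).L2 μ →ₗ[ℂ] (adelicDatum F V).L2 μ))
    (hpπ : ∀ (π : DiscreteAutomorphicRep (adelicDatum F V) μ) (v : (adelicDatum F V).L2 μ), p π v ∈ π.space)
    (hpR : ∀ (π : DiscreteAutomorphicRep (adelicDatum F V) μ) (g : ↥(HodgeCM.HermSpace3.adelicFin V)) (v : (adelicDatum F V).L2 μ),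
      p π ((adelicDatum F V).rightRegular μ (finToAdelic F V g) v) = (adelicDatum F V).rightRegular μ (finToAdelic F V g) (p π v))
    (hdet : ∀ v : (adelicDatum F V).L2 μ, v ≠ 0 → ∃ π : DiscreteAutomorphicRep (adelicDatum F V) μ, p π v ≠ 0)
    (hlift : ∀ (π : DiscreteAutomorphicRep (adelicDatum F V) μ), ∀ f ∈ cohForms 𝔞, ∃ f' ∈ cohForms 𝔞, ∀ k : Fin 2, ℓ f' k = p π (ℓ f k))
    {W : Type} [AddCommGroup W] [Module ℂ W] (σ : Representation ℂ ↥(HodgeCM.HermSpace3.adelicFin V) W)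
    (θ : W →ₗ[ℂ] ((adelicDatum F V).Adelic → (Fin 2 → ℂ))) (hθ0 : θ ≠ 0) (hθA : ∀ w, θ w ∈ cohForms 𝔞)
    (hθσ : ∀ (g : ↥(HodgeCM.HermSpace3.adelicFin V)) (w : W), θ (σ g w) = rightRep F V g (θ w)) :
    ∃ (π : DiscreteAutomorphicRep (adelicDatum F V) μ) (θ' : W →ₗ[ℂ] ((adelicDatum F V).Adelic → (Fin 2 → ℂ))),
      θ' ≠ 0 ∧ (∀ w, θ' w ∈ cotPart F V 𝔞 μ ℓ π) ∧
        ∀ (g : ↥(HodgeCM.HermSpace3.adelicFin V)) (w : W), θ' (σ g w) = rightRep F V g (θ' w) := by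
  obtain ⟨w₀, hw₀⟩ : ∃ w₀ : W, θ w₀ ≠ 0 := by
    by_contra h
    push Not at h
    exact hθ0 (LinearMap.ext h)
  obtain ⟨k₀, hk₀⟩ : ∃ k₀ : Fin 2, ℓ (θ w₀) k₀ ≠ 0 := by
    by_contra h
    push Not at h
    exact hw₀ (injOn_cohForms_of_descents h4 ℓ hrep (θ w₀) (hθA w₀) h)
  obtain ⟨π, hπ⟩ := hdet _ hk₀
  exact ⟨π, exists_occursIn_cotPart_of_proj h4 h𝔞 hrep π (p π) (hpπ π) (hpR π) (hlift π) σ θ hθA hθσ hπ⟩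

end Family

/-! ## §3  At the pin: the orthogonal projections and the letter (D) -/

section Pin

set_option synthInstance.maxHeartbeats 400000 in
set_option maxHeartbeats 8000000 in
/-- **THE LIFTING HYPOTHESIS AT THE FACTOR OF RECORD FROM THE LETTER (D).**  For `4 ≤ [F:ℚ]`, `μ` automorphic, `ℓ` realising `cohForms 𝔞₀` and `Π` discrete automorphic: every
`f ∈ cohForms 𝔞₀` has an `f' ∈ cohForms 𝔞₀` with `ℓ f' k = pr_Π (ℓ f k)` for both `k`.  Split `f = A + B` along `cohForms = holCotForms ⊔ conj holCotForms`; under `Represents`,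
`ℓ A k = [toQuotFun (A · k)]` and `ℓ B k = [toQuotFun (B · k)]` (★ `apply_eq_toLp_of_descents`); the letter (D) (hol on `A`, antihol on `B`, at the pin's CM frame, where
`(𝔞₀.ιinf, 𝔞₀.Kc) = (cmArchSection …, cmCompactFactor …)` by `rfl`) gives `Ψ_A ∈ holCotForms 𝔞₀`, `Ψ_B ∈ conj holCotForms 𝔞₀` with `pr_Π [A_k] = [Ψ_{A,k}]`, `pr_Π [B_k] = [Ψ_{B,k}]`;
take `f' := Ψ_A + Ψ_B`. [cite: BorelJacquet1979, §4.6] [cite: Borel1997, Thm. 2.13 and §8.4] [cite: BorelWallach2000, VII 2.10; XIII 1.2] -/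
theorem lift_of_spectralProjection (hD : holCotFormSpectralProjection) (hD' : antiholCotFormSpectralProjection) (h4 : 4 ≤ Module.finrank ℚ F)
    {μ : Measure (adelicDatum F V).automorphicQuotient} [(adelicDatum F V).IsAutomorphicMeasure μ]
    {ℓ : ((adelicDatum F V).Adelic → (Fin 2 → ℂ)) →ₗ[ℂ] (Fin 2 → (adelicDatum F V).L2 μ)} (hrep : Represents F V (archFactorOf F V) μ ℓ)
    (π : DiscreteAutomorphicRep (adelicDatum F V) μ) :
    ∀ f ∈ cohForms (archFactorOf F V), ∃ f' ∈ cohForms (archFactorOf F V), ∀ k : Fin 2, ℓ f' k = π.space.toSubmodule.starProjection (ℓ f k) := by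
  intro f hf
  have h2 := two_le_finrank_maximalRealSubfield F h4
  -- split `f = A + B`
  obtain ⟨A, hA, B, hB, hAB⟩ := Submodule.mem_sup.mp hf
  have hAc : A ∈ cohForms (archFactorOf F V) := Submodule.mem_sup_left hA
  have hBc : B ∈ cohForms (archFactorOf F V) := Submodule.mem_sup_right hB
  -- the coordinate classes of `A` and `B`
  choose hmA hclA using fun k => apply_eq_toLp_of_descents h4 ℓ hrep hAc k
  choose hmB hclB using fun k => apply_eq_toLp_of_descents h4 ℓ hrep hBc k
  -- the letter (D), twice
  obtain ⟨ΨA, hΨA, hΨAm, heqA⟩ := hD (HodgeCM.CMField.K F) ι₁ (HodgeCM.HermSpace3.Hm V) V.sylvesterFrame (HodgeCM.Model.sylvesterFrame_J V)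
    V.posDef_of_ne h2 μ π A hA hmA
  obtain ⟨ΨB, hΨB, hΨBm, heqB⟩ := hD' (HodgeCM.CMField.K F) ι₁ (HodgeCM.HermSpace3.Hm V) V.sylvesterFrame (HodgeCM.Model.sylvesterFrame_J V)
    V.posDef_of_ne h2 μ π B hB hmB
  have hΨAc : ΨA ∈ cohForms (archFactorOf F V) := Submodule.mem_sup_left ((holCotForms_eq_generic (archFactorOf F V)).symm ▸ hΨA)
  have hΨBc : ΨB ∈ cohForms (archFactorOf F V) :=
    Submodule.mem_sup_right ((holCotForms_eq_generic (archFactorOf F V)).symm ▸ (conjFun_eq_generic F V).symm ▸ hΨB)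
  -- the coordinate classes of `Ψ_A`, `Ψ_B`
  have hclΨA : ∀ k : Fin 2, ℓ ΨA k = (hΨAm k).toLp _ := fun k => by
    obtain ⟨hm, hcl⟩ := apply_eq_toLp_of_descents h4 ℓ hrep hΨAc k
    exact hcl
  have hclΨB : ∀ k : Fin 2, ℓ ΨB k = (hΨBm k).toLp _ := fun k => by
    obtain ⟨hm, hcl⟩ := apply_eq_toLp_of_descents h4 ℓ hrep hΨBc k
    exact hcl
  refine ⟨ΨA + ΨB, Submodule.add_mem _ hΨAc hΨBc, fun k => ?_⟩
  calc ℓ (ΨA + ΨB) k = ℓ ΨA k + ℓ ΨB k := by rw [map_add, Pi.add_apply]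
    _ = π.space.toSubmodule.starProjection ((hmA k).toLp _) + π.space.toSubmodule.starProjection ((hmB k).toLp _) := by
        rw [hclΨA k, hclΨB k, heqA k, heqB k]
    _ = π.space.toSubmodule.starProjection (ℓ A k + ℓ B k) := by rw [map_add, hclA k, hclB k]
    _ = π.space.toSubmodule.starProjection (ℓ f k) := by rw [← Pi.add_apply, ← map_add, hAB]

set_option synthInstance.maxHeartbeats 400000 in
set_option maxHeartbeats 8000000 in
/-- **STUB U2a FROM THE LETTER (D) — `StubU2aSpectralProjection` BY NAME.**  `p_Π :=` the orthogonal projection onto `Π.space` (Mathlib `Submodule.starProjection`): values in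
`Π.space` (`starProjection_apply_mem`), equivariant (★ `DiscreteAutomorphicRep.starProjection_rightRegular`), detecting (★ `exists_discreteAutomorphicRep_starProjection_ne_zero`
with `L²(μ) = L²_disc`, ★ `UnitaryGroup.isDiscretelyDecomposable_rightRegular_adelicGroupData`, `Hm V` anisotropic for `4 ≤ [F:ℚ]`), lifting by `lift_of_spectralProjection`;
then §2. [cite: BorelJacquet1979, §4.6] [cite: GelfandGraevPiatetskiShapiro1969, Ch. 1 §2.3] [cite: Bump1997, Thm. 3.6.1 (proof, pp. 340–342)] [cite: BorelWallach2000, VI; XIII 1.2] -/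
theorem stubU2aSpectralProjection_of_letters (hD : holCotFormSpectralProjection) (hD' : antiholCotFormSpectralProjection) : StubU2aSpectralProjection := by
  intro hDel F _ h6 ι₁ V a₀ Φ hΦ i μ _ ℓ hrep _hn W _ _ σ _hirr hocc
  obtain ⟨θ, hθ0, hθA, hθσ⟩ := hocc
  have h4 : 4 ≤ Module.finrank ℚ F := le_trans (by norm_num) h6
  have hdd : ((adelicDatum F V).rightRegular μ).IsDiscretelyDecomposable :=
    UnitaryGroup.isDiscretelyDecomposable_rightRegular_adelicGroupData (HodgeCM.CMField.K F) 3 (HodgeCM.HermSpace3.Hm V) (anisotropic_Hm h4) μ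
  obtain ⟨π, θ', h1, h2, h3⟩ := exists_occursIn_cotPart_of_projFamily h4 (P4StubT1ArchFactor.archFactorOf_isHonest F V) hrep
    (fun π => (π.space.toSubmodule.starProjection : (adelicDatum F V).L2 μ →L[ℂ] (adelicDatum F V).L2 μ).toLinearMap)
    (fun π v => π.space.toSubmodule.starProjection_apply_mem v)
    (fun π g v => DiscreteAutomorphicRep.starProjection_rightRegular π (finToAdelic F V g) v)
    (fun v hv => exists_discreteAutomorphicRep_starProjection_ne_zero hdd hv)
    (fun π => lift_of_spectralProjection hD hD' h4 hrep π) σ θ hθ0 hθA hθσ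
  exact ⟨π, θ', h1, h2, h3⟩

end Pin

end Summit.HodgeConjecture.HodgeConjecture.Cruxes.H413.P2StubU2a

end
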